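import Literature.Geometry.Lorentzian.SpacelikeBoundaryFuturePoint
import Literature.Geometry.Lorentzian.CorrespondingBoundaryDomain
import HarnessLib

/-!
# Existence of a "spacelike" boundary point among the corresponding ones (Sbierski 2016,
# Lemma 15 "SpacelikePoint"), causal part

J. Sbierski, Ann. Henri Poincaré 17 (2016) 301–329 = arXiv:1309.7591v3, §3.2, Lemma 15:

> *Let `U` be a CGHD of `M` and `M'` with isometric embedding `ψ : U ⊆ M → M'`. Assume that
> `C ∩ J⁺(ι(M̄))` is non-empty. Then there exists a point `p ∈ C` with the property
> `J⁻(p) ∩ ∂U ∩ J⁺(ι(M̄)) = {p}`.*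

Here `C ⊆ ∂U` is the set of boundary points having a corresponding boundary point. This file
isolates the part of the proof which takes place in `M` alone, for an ABSTRACT set
`C ⊆ ∂U ∩ I⁺(S)` (`S` a Cauchy hypersurface of `M` and of the open sub-spacetime `U ⊇ S`) subject
to the two properties of the concrete `C` established elsewhere:

* (open) every point of `C` has a neighbourhood `V` with `V ∩ ∂U ∩ I⁺(S) ⊆ C` (Lemma 14,
  `CorrespondingBoundaryExtension.lean`);
* (closed below its points) if `x_j ∈ C ∩ J⁻(m)`, `m ∈ C`, converge to `x₀ ∈ ∂U ∩ I⁺(S)`, then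
  `x₀ ∈ C` (the corresponding points of the `x_j` lie in the compact set `J⁻(m') ∩ J⁺(S')` of
  `M'` and sub-converge; `SpacelikeCorrespondingBoundaryPoint.lean`).

**Theorem (`LorentzianMetric.IsCauchyHypersurface.exists_spacelikeBoundaryPoint`).** Under the
global-hyperbolicity consequences displayed as in `SpacelikeBoundaryFuturePoint.lean`
(compactness of `J⁻(x) ∩ J⁺(S)`, closedness of `J⁻(x)`, the causality condition), if `C` is
nonempty then some `p ∈ C` satisfies `J⁻(p) ∩ ∂U ∩ J⁺(S) = {p}`.

Proof (replacing the printed descent along a null geodesic of `∂U`, which needs broken null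
geodesics, by a compactness argument). (1) **Segments** (`mem_of_mem_causalPast_of_mem`): for
`m ∈ C` every `q ∈ J⁻(m) ∩ ∂U ∩ J⁺(S)` lies in `C` — a causal curve `ζ` from `q` to `m` runs in
`∂U ∩ I⁺(S)` (an interior point in `U` would pull `q` into `U` by "no causal entry",
`IsAchronal.mem_opens_of_mem_causalFuture`; an exterior point has points `r ≪ m` of the
exterior nearby, `J⁻(m) ⊆ closure I⁻(m)`, which lie in `U` by "no timelike entry"), and the
set of parameters `t` with `ζ t ∈ C` is open by (open) and closed by (closed below `m`), hence
all of `[a, b]` (continuous induction, `IsClosed.mem_of_ge_of_forall_exists_lt`). (2) **Minimal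
element**: `K = C ∩ J⁻(p₀)` (`p₀ ∈ C`) is compact (closed in the compact `J⁻(p₀) ∩ J⁺(S)` by
(closed below `p₀`)); by Zorn's lemma for the causal order on `K` — chains have lower bounds by
the finite intersection property of the closed sets `J⁻(x) ∩ K` (`IsCompact.inter_iInter_nonempty`)
— there is a causally minimal `p ∈ K`: every `q ∈ K` with `q ≤ p` has `p ≤ q`, hence `q = p`
(no closed causal curves, `eq_of_mem_causalFuture_of_mem_causalFuture`). With (1), `p` is the
required point.

Everything is proved; no definitions, no named facts (D-0026).

## References

* J. Sbierski, Ann. Henri Poincaré 17 (2016) 301–329 = arXiv:1309.7591v3, §3.2, Lemma 15 and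
  its proof (arXiv numbering). [Sbierski2016AHP]
* B. O'Neill, *Semi-Riemannian geometry with applications to relativity*, Academic Press 1983,
  Ch. 14, Lemma 14.6, Lemma 14.22, Cor. 14.1. [ONeillSemiRiemannian1983]
* H. Ringström, *The Cauchy Problem in General Relativity*, EMS 2009, Ch. 23. [Ringstrom2009]
-/

noncomputable section

open Set Filter Function TopologicalSpace Topology
open scoped Manifold ContDiff Topology

namespace Literature.Geometry.Lorentzian

namespace LorentzianMetric

variable {E : Type*} [NormedAddCommGroup E] [NormedSpace ℝ E] {H : Type*} [TopologicalSpace H]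
  {I : ModelWithCorners ℝ E H} {n : ℕ∞ω} {M : Type*} [TopologicalSpace M] [ChartedSpace H M]
  [IsManifold I ∞ M] [T2Space M] [SecondCountableTopology M] [BoundarylessManifold I M]
  [FiniteDimensional ℝ E] {g : LorentzianMetric I n M} {τ : TimeOrientation g}

omit [T2Space M] [SecondCountableTopology M] [FiniteDimensional ℝ E] in
/-- **The causal relation of a causal spacetime is antisymmetric**: `y ∈ J⁺(x)` and `x ∈ J⁺(y)`
force `x = y`, for otherwise the two causal curves concatenate (with rounded corner,
`exists_isFutureCausalCurveOn_trans`) to a closed causal curve. O'Neill 1983, Ch. 14, p. 407.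
[cite: ONeillSemiRiemannian1983, Ch. 14, p. 407] -/
theorem eq_of_mem_causalFuture_of_mem_causalFuture (hn : 1 ≤ n) (hcaus : g.IsCausallyWellBehaved τ)
    {x y : M} (hxy : y ∈ g.causalFuture τ {x}) (hyx : x ∈ g.causalFuture τ {y}) : x = y := by
  by_contra hne
  rcases hxy with hxy | ⟨x₀, hx₀, γ₁, a₁, b₁, hab₁, hγ₁, hγ₁a, hγ₁b⟩
  · exact hne (mem_singleton_iff.1 hxy).symm
  rcases hyx with hyx | ⟨y₀, hy₀, γ₂, a₂, b₂, hab₂, hγ₂, hγ₂a, hγ₂b⟩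
  · exact hne (mem_singleton_iff.1 hyx)
  rw [mem_singleton_iff] at hx₀ hy₀
  subst hx₀ hy₀
  obtain ⟨γ, a, b, hab, hγ, hγa, hγb⟩ :=
    exists_isFutureCausalCurveOn_trans hn hab₁ hab₂ hγ₁ hγ₂ (by rw [hγ₁b, hγ₂a])
  exact hcaus γ a b hab hγ (by rw [hγa, hγb, hγ₁a, hγ₂b])

/-- **A causal curve between a point of `∂U ∩ J⁺(S)` and a point of `Ū` runs in `∂U ∩ I⁺(S)`**
(for `S` a Cauchy hypersurface of `M` contained in the open `U`, in which it is a Cauchy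
hypersurface): an interior point in `U` would put the initial point in `U` ("no causal entry",
`IsAchronal.mem_opens_of_mem_causalFuture`); a point of the exterior of `U` has points `r ≪ m` of
the exterior nearby (`J⁻(m) ⊆ closure I⁻(m)`), which lie in `U` ("no timelike entry",
`IsAchronal.mem_opens_of_mem_closure_of_mem_chronologicalFuture`). Sbierski 2016, §3.2, proof of
Lemma 15 ("note that `γ([0,1]) ⊆ ∂U`"). [cite: Sbierski2016AHP, §3.2, proof of Lemma 15 (arXiv numbering)] -/
theorem frontier_of_isFutureCausalCurveOn (hn : 2 ≤ n)
    (hres : PseudoRiemannianMetric.contMDiff_restrict (I := I) (n := n) (M := M))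
    (hτ : τ.contMDiff_restrict) {S : Set M} (hS : g.IsCauchyHypersurface τ S) {U : Opens M}
    (hSU : S ⊆ U)
    (hU : (g.restrict hres U).IsCauchyHypersurface (τ.restrict hres hτ U) (Subtype.val ⁻¹' S))
    {ζ : ℝ → M} {a b : ℝ} (hζ : g.IsFutureCausalCurveOn τ ζ (Icc a b))
    (hqa : ζ a ∈ frontier (U : Set M)) (hqS : ζ a ∈ g.causalFuture τ S)
    (hmb : ζ b ∈ closure (U : Set M)) {t : ℝ} (ht : t ∈ Icc a b) :
    ζ t ∈ frontier (U : Set M) ∧ ζ t ∈ g.chronologicalFuture τ S := by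
  have hn1 : (1 : ℕ∞ω) ≤ n := le_trans one_le_two hn
  have hA : g.IsAchronal τ S := IsCauchyHypersurface.isAchronal_holds hn hS
  have hqU : ζ a ∉ U := fun h ↦ (eq_empty_iff_forall_notMem.1 U.2.inter_frontier_eq) _ ⟨h, hqa⟩
  have htq : ζ t ∈ g.causalFuture τ {ζ a} := mem_causalFuture_of_curve hζ le_rfl ht.1 ht.2
  have htm : ζ b ∈ g.causalFuture τ {ζ t} := mem_causalFuture_of_curve hζ ht.1 ht.2 le_rfl
  have htS : ζ t ∈ g.causalFuture τ S := by
    rw [← causalFuture_causalFuture_eq hn S, causalFuture_eq_biUnion]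
    simp only [mem_iUnion, exists_prop]
    exact ⟨ζ a, hqS, htq⟩
  -- `ζ t ∉ U`
  have htU : ζ t ∉ U := fun h ↦ hqU (hA.mem_opens_of_mem_causalFuture hn hres hτ hU hqS h htq)
  have htSm : ζ t ∉ S := fun h ↦ htU (hSU h)
  have htI : ζ t ∈ g.chronologicalFuture τ S :=
    hS.mem_chronologicalFuture_of_mem_causalFuture_diff hn htS htSm
  -- `ζ t ∈ closure U`
  have htcl : ζ t ∈ closure (U : Set M) := by
    by_contra hcl
    have hopen : IsOpen ((closure (U : Set M))ᶜ ∩ g.chronologicalFuture τ S) :=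
      isClosed_closure.isOpen_compl.inter (isOpen_chronologicalFuture_of_boundaryless _ _ _)
    have hmem : ζ t ∈ closure (g.chronologicalPast τ {ζ b}) :=
      causalFuture_subset_closure_chronologicalFuture_of_boundaryless (τ := τ.reverse) hn1 {ζ b}
        (mem_causalPast_singleton_iff.2 htm)
    obtain ⟨r, ⟨hrcl, hrI⟩, hrm⟩ := mem_closure_iff.1 hmem _ hopen ⟨hcl, htI⟩
    have hmr : ζ b ∈ g.chronologicalFuture τ {r} := mem_chronologicalFuture_of_mem_chronologicalPast hrm
    have hrU : r ∈ U :=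
      hA.mem_opens_of_mem_closure_of_mem_chronologicalFuture hn hres hτ hU
        (chronologicalFuture_subset_causalFuture _ _ _ hrI) hmb hmr
    exact hrcl (subset_closure hrU)
  refine ⟨⟨htcl, ?_⟩, htI⟩
  rw [U.isOpen.interior_eq]
  exact htU

/-- **Segments: `C` contains `J⁻(m) ∩ ∂U ∩ J⁺(S)` for each of its points `m`**, when
`C ⊆ ∂U ∩ I⁺(S)` is open in `∂U ∩ I⁺(S)` and closed under limits of its points below `m`. The
causal curve from such a `q` to `m` runs in `∂U ∩ I⁺(S)` (`frontier_of_isFutureCausalCurveOn`) and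
the set of its parameters mapped into `C` is open and closed in `[a, b]` and contains `b`
(continuous induction downwards, `IsClosed.mem_of_ge_of_forall_exists_lt`). Sbierski 2016, §3.2,
proof of Lemma 15 ("We first show that `J := {t ∈ [0,b] | γ(t) ∈ C}` is equal to `[0,b]`").
[cite: Sbierski2016AHP, §3.2, proof of Lemma 15 (arXiv numbering)] -/
theorem mem_of_mem_causalPast_of_mem (hn : 2 ≤ n)
    (hres : PseudoRiemannianMetric.contMDiff_restrict (I := I) (n := n) (M := M))
    (hτ : τ.contMDiff_restrict) {S : Set M} (hS : g.IsCauchyHypersurface τ S) {U : Opens M}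
    (hSU : S ⊆ U)
    (hU : (g.restrict hres U).IsCauchyHypersurface (τ.restrict hres hτ U) (Subtype.val ⁻¹' S))
    {C : Set M} (hCfr : C ⊆ frontier (U : Set M))
    (hopen : ∀ z ∈ C, ∃ V ∈ 𝓝 z, ∀ w ∈ V, w ∈ frontier (U : Set M) →
      w ∈ g.chronologicalFuture τ S → w ∈ C)
    {m : M} (hm : m ∈ C)
    (hclosed : ∀ (x : ℕ → M) (x₀ : M), (∀ j, x j ∈ C ∧ x j ∈ g.causalPast τ {m}) →
      Tendsto x atTop (𝓝 x₀) → x₀ ∈ frontier (U : Set M) → x₀ ∈ g.chronologicalFuture τ S →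
      x₀ ∈ C)
    {q : M} (hqm : q ∈ g.causalPast τ {m}) (hqfr : q ∈ frontier (U : Set M))
    (hqS : q ∈ g.causalFuture τ S) : q ∈ C := by
  have hmq : m ∈ g.causalFuture τ {q} := mem_causalPast_singleton_iff.1 hqm
  rcases hmq with hmq | ⟨q₀, hq₀, ζ, a, b, hab, hζ, hζa, hζb⟩
  · rw [mem_singleton_iff] at hmq; rw [← hmq]; exact hm
  rw [mem_singleton_iff] at hq₀
  subst hq₀
  have hseg : ∀ t ∈ Icc a b, ζ t ∈ frontier (U : Set M) ∧ ζ t ∈ g.chronologicalFuture τ S :=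
    fun t ht ↦ frontier_of_isFutureCausalCurveOn hn hres hτ hS hSU hU hζ (by rw [hζa]; exact hqfr)
      (by rw [hζa]; exact hqS) (by rw [hζb]; exact frontier_subset_closure (hCfr hm)) ht
  have hcont : ∀ t ∈ Icc a b, ContinuousAt ζ t := fun t ht ↦ (hζ t ht).1.continuousAt
  -- continuous induction on `s = {t | ζ t ∈ C}`, downwards from `b`
  set s : Set ℝ := {t | ζ t ∈ C} with hs
  suffices ha : a ∈ s by rw [← hζa]; exact ha
  refine IsClosed.mem_of_ge_of_forall_exists_lt ?_ (by show ζ b ∈ C; rw [hζb]; exact hm) hab.le ?_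
  · -- `s ∩ [a, b]` is closed
    refine isClosed_of_closure_subset fun t ht ↦ ?_
    have htI : t ∈ Icc a b := closure_mono inter_subset_right ht |> (closure_Icc a b).subset
    obtain ⟨u, hu, hulim⟩ := mem_closure_iff_seq_limit.1 ht
    refine ⟨hclosed (fun j ↦ ζ (u j)) (ζ t) (fun j ↦ ⟨(hu j).1, ?_⟩)
      ((hcont t htI).tendsto.comp hulim) (hseg t htI).1 (hseg t htI).2, htI⟩
    exact mem_causalPast_singleton_iff.2
      (by rw [← hζb]; exact mem_causalFuture_of_curve hζ (hu j).2.1 (hu j).2.2 le_rfl)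
  · -- openness: left of a parameter in `s` there are parameters in `s`
    rintro x ⟨hxs, hx⟩
    have hxI : x ∈ Icc a b := ⟨hx.1.le, hx.2⟩
    obtain ⟨V, hV, hVC⟩ := hopen (ζ x) hxs
    have hev : ∀ᶠ t in 𝓝 x, ζ t ∈ V := (hcont x hxI).preimage_mem_nhds hV
    have hev' : ∀ᶠ t in 𝓝[<] x, ζ t ∈ V ∧ t ∈ Ioo a x :=
      (hev.filter_mono nhdsWithin_le_nhds).and (Ioo_mem_nhdsLT hx.1)
    obtain ⟨t, htV, ht⟩ := hev'.exists
    have htI' : t ∈ Icc a b := ⟨ht.1.le, ht.2.le.trans hx.2⟩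
    exact ⟨t, hVC _ htV (hseg t htI').1 (hseg t htI').2, ht.1.le, ht.2⟩

/-- **Sbierski's Lemma 15, causal part: a causally minimal point of `C`.** Let `S` be a Cauchy
hypersurface of `(M, g, τ)` contained in the open `U`, in which it is a Cauchy hypersurface;
assume `J⁻(x) ∩ J⁺(S)` compact and `J⁻(x)` closed for every `x`, and the causality condition.
Let `C ⊆ ∂U ∩ I⁺(S)` be open in `∂U ∩ I⁺(S)` and closed under limits of its points below each
of its points (see the module docstring). Then if `C` is nonempty, some `p ∈ C` satisfies
`J⁻(p) ∩ ∂U ∩ J⁺(S) = {p}` — the hypothesis `hsp` of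
`IsCauchyHypersurface.exists_causalPast_inter_compl_subset` (Lemma 16). See the module docstring
for the proof. [cite: Sbierski2016AHP, §3.2, Lemma 15 (arXiv numbering)] -/
theorem IsCauchyHypersurface.exists_spacelikeBoundaryPoint (hn : 2 ≤ n)
    (hres : PseudoRiemannianMetric.contMDiff_restrict (I := I) (n := n) (M := M))
    (hτ : τ.contMDiff_restrict) {S : Set M} (hS : g.IsCauchyHypersurface τ S) {U : Opens M}
    (hSU : S ⊆ U)
    (hU : (g.restrict hres U).IsCauchyHypersurface (τ.restrict hres hτ U) (Subtype.val ⁻¹' S))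
    (hK : ∀ x : M, IsCompact (g.causalPast τ {x} ∩ g.causalFuture τ S))
    (hJ : ∀ x : M, IsClosed (g.causalPast τ {x})) (hcaus : g.IsCausallyWellBehaved τ)
    {C : Set M} (hCfr : C ⊆ frontier (U : Set M)) (hCI : C ⊆ g.chronologicalFuture τ S)
    (hopen : ∀ z ∈ C, ∃ V ∈ 𝓝 z, ∀ w ∈ V, w ∈ frontier (U : Set M) →
      w ∈ g.chronologicalFuture τ S → w ∈ C)
    (hclosed : ∀ m ∈ C, ∀ (x : ℕ → M) (x₀ : M), (∀ j, x j ∈ C ∧ x j ∈ g.causalPast τ {m}) →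
      Tendsto x atTop (𝓝 x₀) → x₀ ∈ frontier (U : Set M) → x₀ ∈ g.chronologicalFuture τ S →
      x₀ ∈ C)
    {p₀ : M} (hp₀ : p₀ ∈ C) :
    ∃ p ∈ C, ∀ q ∈ g.causalPast τ {p} ∩ frontier (U : Set M) ∩ g.causalFuture τ S, q = p := by
  classical
  haveI : LocallyCompactSpace M := Manifold.locallyCompact_of_finiteDimensional (M := M) I
  haveI : TopologicalSpace.MetrizableSpace M := Manifold.metrizableSpace I M
  letI : MetricSpace M := TopologicalSpace.metrizableSpaceMetric M
  have hn1 : (1 : ℕ∞ω) ≤ n := le_trans one_le_two hn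
  -- the compact set `K = C ∩ J⁻(p₀)`
  set K : Set M := C ∩ g.causalPast τ {p₀} with hK_def
  have hKQ : K ⊆ g.causalPast τ {p₀} ∩ g.causalFuture τ S := fun x hx ↦
    ⟨hx.2, chronologicalFuture_subset_causalFuture _ _ _ (hCI hx.1)⟩
  have hKcl : IsClosed K := by
    refine isClosed_of_closure_subset fun x₀ hx₀ ↦ ?_
    obtain ⟨u, hu, hulim⟩ := mem_closure_iff_seq_limit.1 hx₀
    have hQcl : IsClosed (g.causalPast τ {p₀} ∩ g.causalFuture τ S) := (hK p₀).isClosed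
    have hx₀Q : x₀ ∈ g.causalPast τ {p₀} ∩ g.causalFuture τ S :=
      hQcl.closure_subset (closure_mono hKQ hx₀)
    have hx₀fr : x₀ ∈ frontier (U : Set M) :=
      isClosed_frontier.closure_subset (closure_mono (fun x hx ↦ hCfr hx.1) hx₀)
    have hx₀U : x₀ ∉ U := fun h ↦ (eq_empty_iff_forall_notMem.1 U.2.inter_frontier_eq) _ ⟨h, hx₀fr⟩
    have hx₀I : x₀ ∈ g.chronologicalFuture τ S :=
      hS.mem_chronologicalFuture_of_mem_causalFuture_diff hn hx₀Q.2 fun h ↦ hx₀U (hSU h)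
    exact ⟨hclosed p₀ hp₀ u x₀ (fun j ↦ hu j) hulim hx₀fr hx₀I, hx₀Q.1⟩
  have hKc : IsCompact K := (hK p₀).of_isClosed_subset hKcl hKQ
  have hp₀K : p₀ ∈ K := ⟨hp₀, subset_causalFuture (g := g) (τ := τ.reverse) _ rfl⟩
  -- Zorn's lemma for the reversed causal order on `K`
  letI : Preorder K :=
    { le := fun x y ↦ (x : M) ∈ g.causalFuture τ {(y : M)}
      le_refl := fun x ↦ subset_causalFuture (g := g) (τ := τ) _ rfl
      le_trans := fun x y z hxy hyz ↦
        mem_causalFuture_of_mem_causalFuture_of_mem_causalFuture hn hyz hxy }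
  haveI : Nonempty K := ⟨⟨p₀, hp₀K⟩⟩
  have hzorn : ∃ m : K, IsMax m := by
    refine zorn_le_nonempty fun c hc hcne ↦ ?_
    -- a lower bound of the chain: a point of `K ∩ ⋂_{x ∈ c} J⁻(x)`
    have hfip : (K ∩ ⋂ x : c, g.causalPast τ {((x : K) : M)}).Nonempty := by
      refine hKc.inter_iInter_nonempty _ (fun x ↦ hJ _) fun u ↦ ?_
      rcases u.eq_empty_or_nonempty with hu | hu
      · rw [hu]
        simp only [Finset.notMem_empty, iInter_of_empty, iInter_univ, inter_univ]
        exact ⟨p₀, hp₀K⟩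
      · -- the largest element of the finite chain `u` (the causally earliest)
        obtain ⟨i₀, hi₀u, hi₀max⟩ := Finset.exists_maximal hu
        refine ⟨((i₀ : c) : K), ((i₀ : c) : K).2, ?_⟩
        simp only [mem_iInter]
        intro i hi
        have hle : ((i : c) : K) ≤ ((i₀ : c) : K) := by
          by_cases heq : i = i₀
          · rw [heq]
          · have hne : ((i : c) : K) ≠ ((i₀ : c) : K) := fun h ↦ heq (Subtype.ext h)
            rcases hc i.2 i₀.2 hne with h | h
            · exact h
            · exact hi₀max hi h
        exact mem_causalPast_singleton_iff.2 hle
    obtain ⟨z, hzK, hz⟩ := hfip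
    refine ⟨⟨z, hzK⟩, fun x hx ↦ ?_⟩
    simp only [mem_iInter] at hz
    exact mem_causalPast_singleton_iff.1 (hz ⟨x, hx⟩)
  obtain ⟨m, hmax⟩ := hzorn
  refine ⟨m, m.2.1, fun q hq ↦ ?_⟩
  obtain ⟨⟨hqm, hqfr⟩, hqS⟩ := hq
  -- `q ∈ C` by the segment lemma, hence `q ∈ K`
  have hqC : q ∈ C :=
    mem_of_mem_causalPast_of_mem hn hres hτ hS hSU hU hCfr hopen m.2.1 (hclosed _ m.2.1) hqm hqfr hqS
  have hmq : (m : M) ∈ g.causalFuture τ {q} := mem_causalPast_singleton_iff.1 hqm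
  have hqp₀ : q ∈ g.causalPast τ {p₀} :=
    mem_causalPast_singleton_iff.2 (mem_causalFuture_of_mem_causalFuture_of_mem_causalFuture hn hmq
      (mem_causalPast_singleton_iff.1 m.2.2))
  have hqK : q ∈ K := ⟨hqC, hqp₀⟩
  -- maximality: `q ≤ m` in the causal order forces `m ≤ q`, hence `q = m`
  have hle : m ≤ ⟨q, hqK⟩ := hmq
  have hge : (⟨q, hqK⟩ : K) ≤ m := hmax hle
  exact eq_of_mem_causalFuture_of_mem_causalFuture hn1 hcaus hmq hge

end LorentzianMetric

end Literature.Geometry.Lorentzian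

end
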